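import Summits.Ventures.CertifiedManyBodySolver.Certificates.HubbardSquare_cellword_KitN1
import Summits.Ventures.CertifiedManyBodySolver.Certificates.HubbardSquare_cellword_KitEdge
import HarnessLib

/-!
# Ventures/CertifiedManyBodySolver — Certificates/HubbardSquare_cellword_KitN1Edge.lean (hubbard-box-eng-2 g3, cell hubbard-fast)

HONEST FRAMING: transport bookkeeping of certified ground-state-energy bounds; not a superconductivity verdict; not a
pairing bound; no number is certified in this file — two GENERIC composition lemmas combining the half-filling slab device
(`HubbardSquare_cellword_KitN1`) with the kinematic `t′`-edge device (`HubbardSquare_cellword_KitEdge`) for parent-compound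
material boxes whose `t′` range leaves the half-filling census columns (e.g. Ca₂CuO₂Cl₂: `t′/t_eff ∈ [−0.41, −0.30]`,
`n ∈ [0.99, 1.01]`; the half-filling census stops at `t′ = −3/10`):
* `cell_edge_strip_lower_n1` — half-filling floors `L₁, L₂` at two nodes `(s₁,U₁)`, `(s₁,U₂)` of one column floor the slab
  `[n₁, n₂]` (`n₁ < 1`, `n₂ < 2`) on `|s − s₁| ≤ w`, `U ∈ [U₁, U₂]` by `min ((2−n₁)m − U₂(1−n₁)) (min m (n₂ m))`,
  `m = min L₁ L₂ − (1621139/10⁶)·w`;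
* `cell_edge_shadow_lower_n1` — one half-filling floor `L` at `(s₁,U₁)` floors the slab on `|s − s₁| ≤ w`, `U₁ ≤ U ≤ U_b`
  (the U-shadow) by `min ((2−n₁)m − U_b(1−n₁)) (min m (n₂ m))`, `m = L − (1621139/10⁶)·w`.
-/

noncomputable section

namespace Summit.Ventures.CertifiedManyBodySolver.Certificates

open Matrix Finset Filter Topology
open Literature.MathematicalPhysics.QuantumLattice
open Literature.MathematicalPhysics.QuantumLattice.ThermodynamicLimit
open Literature.Probability.LatticeModels
open scoped ComplexOrder ComplexConjugate Topology BigOperators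

/-- `16/π² < 1.621139` (the engine's K-row constant, outward). [cite: LiebLoss1993, §8, Theorem 8.2] -/
private theorem sixteen_div_pi_sq_lt_Krow' : 16 / Real.pi ^ 2 < (1621139/1000000 : ℝ) := by
  have hπ : (3.14159265358979323846 : ℝ) < Real.pi := Real.pi_gt_d20
  have hpos : (0 : ℝ) < Real.pi ^ 2 := by positivity
  have hsq : (9.869604401 : ℝ) < Real.pi ^ 2 := by nlinarith
  rw [div_lt_iff₀ hpos]
  nlinarith

/-- **Edge strip × half-filling slab.** Half-filling floors `L₁ ≤ e(s₁,U₁,1)`, `L₂ ≤ e(s₁,U₂,1)` (`0 ≤ U₁ < U₂`) give, for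
`|s − s₁| ≤ w`, `U ∈ [U₁, U₂]` and `n ∈ [n₁, n₂]` (`0 < n₁ < 1`, `n₂ < 2`), with `m = min L₁ L₂ − (1621139/10⁶) w`:
`min ((2 − n₁) m − U₂ (1 − n₁)) (min m (n₂ m)) ≤ e(s,U,n)` (`cell_edge_strip_lower` at `n = 1`, then `cell_node_floor_n1`,
then `U ≤ U₂` in the particle–hole term). [cite: LiebWuPhysicaA2003, §1 eq. (3)] -/
theorem cell_edge_strip_lower_n1 {s₁ U₁ U₂ L₁ L₂ n₁ n₂ w : ℝ} (hU₁ : 0 ≤ U₁) (hU : U₁ < U₂)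
    (hn₁ : 0 < n₁) (h₁n : n₁ < 1) (hn₂ : n₂ < 2)
    (h₁ : L₁ ≤ energyDensityTT' 1 s₁ U₁ 1) (h₂ : L₂ ≤ energyDensityTT' 1 s₁ U₂ 1)
    {s U n : ℝ} (hw : |s - s₁| ≤ w) (hU₁' : U₁ ≤ U) (hU₂' : U ≤ U₂) (hn : n ∈ Set.Icc n₁ n₂) :
    min ((2 - n₁) * (min L₁ L₂ - 1621139/1000000 * w) - U₂ * (1 - n₁))
      (min (min L₁ L₂ - 1621139/1000000 * w) (n₂ * (min L₁ L₂ - 1621139/1000000 * w))) ≤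
      energyDensityTT' 1 s U n := by
  have hc₁ : ∀ m ∈ Set.Icc (1:ℝ) 1, L₁ ≤ energyDensityTT' 1 s₁ U₁ m := by
    intro m hm; rw [le_antisymm hm.2 hm.1]; exact h₁
  have hc₂ : ∀ m ∈ Set.Icc (1:ℝ) 1, L₂ ≤ energyDensityTT' 1 s₁ U₂ m := by
    intro m hm; rw [le_antisymm hm.2 hm.1]; exact h₂
  have hE := cell_edge_strip_lower (n₁ := 1) (n₂ := 1) hU₁ hU (by norm_num) (by norm_num) hc₁ hc₂ hw hU₁' hU₂'
    ⟨le_rfl, le_rfl⟩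
  have hU0 : 0 ≤ U := hU₁.trans hU₁'
  have key := cell_node_floor_n1 (n₁ := n₁) (n₂ := n₂) hU0 hn₁ h₁n hn₂ hE hn
  refine le_trans (min_le_min ?_ le_rfl) key
  have h1n : 0 ≤ 1 - n₁ := by linarith
  nlinarith [mul_le_mul_of_nonneg_right hU₂' h1n]

/-- **Edge strip × half-filling slab on a U-shadow.** One half-filling floor `L ≤ e(s₁,U₁,1)` (`0 ≤ U₁`) gives, for
`|s − s₁| ≤ w`, `U₁ ≤ U ≤ U_b` and `n ∈ [n₁, n₂]` (`0 < n₁ < 1`, `n₂ < 2`), with `m = L − (1621139/10⁶) w`: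
`min ((2 − n₁) m − U_b (1 − n₁)) (min m (n₂ m)) ≤ e(s,U,n)` (kinematic `t′`-Lipschitz at `(U₁, n = 1)`, `cell_node_floor_n1` at
`U₁`, monotonicity in `U` at each density of the slab). [cite: LiebWuPhysicaA2003, §1 eq. (3)] -/
theorem cell_edge_shadow_lower_n1 {s₁ U₁ Ub L n₁ n₂ w : ℝ} (hU₁ : 0 ≤ U₁)
    (hn₁ : 0 < n₁) (h₁n : n₁ < 1) (hn₂ : n₂ < 2) (hL : L ≤ energyDensityTT' 1 s₁ U₁ 1)
    {s U n : ℝ} (hw : |s - s₁| ≤ w) (hU₁' : U₁ ≤ U) (hUb : U ≤ Ub) (hn : n ∈ Set.Icc n₁ n₂) :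
    min ((2 - n₁) * (L - 1621139/1000000 * w) - Ub * (1 - n₁))
      (min (L - 1621139/1000000 * w) (n₂ * (L - 1621139/1000000 * w))) ≤ energyDensityTT' 1 s U n := by
  have hn0 : 0 ≤ n := by linarith [hn.1]
  have hn2 : n < 2 := by linarith [hn.2]
  have hk := energyDensityTT'_sub_sixteen_div_pi_sq_mul_le 1 hU₁ (n := 1) (by norm_num) (by norm_num) s₁ s
  have hw0 : 0 ≤ w := (abs_nonneg _).trans hw
  have hpi : 0 ≤ 16 / Real.pi ^ 2 := by positivity
  have h3 : 16 / Real.pi ^ 2 * |s - s₁| ≤ 1621139/1000000 * w :=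
    (mul_le_mul_of_nonneg_left hw hpi).trans (mul_le_mul_of_nonneg_right sixteen_div_pi_sq_lt_Krow'.le hw0)
  have hE : L - 1621139/1000000 * w ≤ energyDensityTT' 1 s U₁ 1 := by linarith
  have key := cell_node_floor_n1 (n₁ := n₁) (n₂ := n₂) hU₁ hn₁ h₁n hn₂ hE hn
  have hmono : energyDensityTT' 1 s U₁ n ≤ energyDensityTT' 1 s U n := energyDensityTT'_mono_U 1 s hn0 hn2 hU₁ hU₁'
  refine le_trans (min_le_min ?_ le_rfl) (key.trans hmono)
  have h1n : 0 ≤ 1 - n₁ := by linarith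
  nlinarith [mul_le_mul_of_nonneg_right (hU₁'.trans hUb) h1n]

end Summit.Ventures.CertifiedManyBodySolver.Certificates

end
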